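import Summits.QuantumFields.YangMills.Theorems.MirrorModularBoostsHypercubicLimitOfLineInputs
import Summits.QuantumFields.YangMills.Theorems.MirrorModularBoostsHypercubicLimitSoftFloorsSubseq
import Summits.QuantumFields.YangMills.Theorems.MirrorModularBoostsHypercubicLimitPlaneSumGrowth
import Summits.QuantumFields.YangMills.Theorems.MirrorModularBoostsHypercubicLimitConvergenceSubseq
import Summits.QuantumFields.YangMills.Theorems.PencilRigidityWeakCouplingHypercubicLimitSiblingTie
import Summits.QuantumFields.YangMills.Theorems.LangevinControlUVOSLegsFromFemtoAndGapStubGap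
import Summits.QuantumFields.YangMills.Theorems.PencilRigidityWeakCouplingHypercubicLimitStubNtOfSkewSeparated
import Summits.QuantumFields.YangMills.Theorems.PencilRigidityWeakCouplingHypercubicLimitStubSkewSeparatedOfLatticeFloor
import Summits.QuantumFields.YangMills.Theorems.PencilRigidityWeakCouplingHypercubicLimitStubCountertermBoundOfSkewFloor
import HarnessLib

/-!
# Crux `WeakCouplingHypercubicLimit` (stmt-QuantumFields-16120) from the SKEW CORE — the non-triviality floor is redundant

Line `Sketch` of crux stmt-16120 (`Summit.QuantumFields.YangMills.Theses.PencilRigidity.WeakCouplingHypercubicLimit`; by `stub_siblingTie` the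
same statement as the twin stmt-16154), reshape r12 of the continuation lead c5.  The common core of r11 (landed
`weakCouplingHypercubicLimit_of_latticeCore`: weak coupling ∧ `PolyVolume` ∧ `PolyRenorm` ∧ `UniformMomentBoundsPlanes` ∧ `IRInputs`)
carries TWO lattice floors inside `IRInputs`: (c) non-triviality of the truncated two-point function and (d) a `κ₃` floor.  If the `κ₃`
floor is asked in TIME-SEPARATED position (`f` at negative times, `g, h` at positive times, `g, h` disjointly supported), then (c) is NOT
NEEDED: the limit family is reflection positive on positive-time tuples (`RPPos`, landed `stub_rpPosOfPlaneLimits`), hence satisfies the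
connected Cauchy–Schwarz inequality `ConnCS` (landed `stub_gap`), and a family with `ConnCS` all of whose time-ordered truncated two-point
functions vanished would have `conn(F, G) = 0` for every positive-time `G` of every arity, so its third cumulant in time-separated position
would vanish (landed `stub_ntOfSkewSeparated`) — contradicting the `κ₃` floor passed to the limit with its geometry (landed
`stub_skewSeparatedOfLatticeFloor`).  The bounded counterterm is forced by the `κ₃` floor as well (landed `stub_countertermBoundOfSkewFloor`:
third cumulants of bounded variables are bounded, so the floor bounds `|c_k|` below, and the order-one moment bound does the rest).

So the SKEW CORE — for every compact simple `G`, `∃ r sch`: `β_k → ∞` ∧ `PolyVolume` ∧ `PolyRenorm` ∧ `UniformMomentBoundsPlanes r sch` ∧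
(`∃ Δ C, 0 < Δ ∧ HasLatticeMassGap r sch Δ ∧ RPSpectral r sch Δ C`) ∧ ONE time-separated `κ₃` floor — implies the crux BY NAME
(`weakCouplingHypercubicLimit_of_latticeSkewCore`) and the twin (`hypercubicLimit_of_latticeSkewCore`).  Six conjuncts: weak coupling, two
witness-side growth conditions, the UV moment bounds, the IR gap in its two lattice forms, non-Gaussianity.

Refs: OsterwalderSchrader1973 §§2–4 (E2, reconstruction, Cauchy–Schwarz); GlimmJaffe1987 §6.1, §19.7; OsterwalderSeiler1978 §§2–3.
-/

noncomputable section

open scoped SchwartzMap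
open MeasureTheory Filter Topology
open Literature.MathematicalPhysics.AQFT Literature.MathematicalPhysics.QuantumLattice
open Literature.MathematicalPhysics.QuantumFieldTheory
open Summit.QuantumFields.YangMills.Cruxes.HypercubicLimit.CouplingResponse
open Summit.QuantumFields.YangMills.Cruxes.OSLegsFromFemtoAndGap.DlrCollarTransfer (conn Decay RPPos ConnCS)

namespace Summit.QuantumFields.YangMills.Theorems.WeakCouplingHypercubicLimit.TraceNormColdPressure

/-- **The skew core gives a weak-coupling one-field witness.**  From weak coupling, `PolyVolume`, `PolyRenorm`,
`UniformMomentBoundsPlanes`, the uniform lattice gap with its RP-spectral form, and ONE time-separated `κ₃` floor: the one-field clauses on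
a weak-coupling sub-scheme (non-triviality DERIVED from non-Gaussianity through `ConnCS`). [folklore] -/
theorem oneFieldClauses_of_latticeSkewCore
    {G : Type} [Group G] [TopologicalSpace G] [IsTopologicalGroup G] [CompactSpace G] [MeasurableSpace G] [BorelSpace G]
    (r : LatticeRep G) (sch : SpeciesScheme (YMSpecies G))
    (hw : sch.HasWeakCouplingLimit) (hpv : PolyVolume sch) (hpr : PolyRenorm r sch) (hUMB : UniformMomentBoundsPlanes r sch)
    {Δ C : ℝ} (hΔ : 0 < Δ) (hgap : HasLatticeMassGap r sch Δ) (hrp : RPSpectral r sch Δ C)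
    (hNG : ∃ (f g h : 𝓢(EuclideanSpace ℝ (Fin 4), ℝ)) (δ : ℝ),
        tsupport f ⊆ {y : EuclideanSpace ℝ (Fin 4) | y 0 < 0} ∧ tsupport g ⊆ {y : EuclideanSpace ℝ (Fin 4) | 0 < y 0} ∧ tsupport h ⊆ {y : EuclideanSpace ℝ (Fin 4) | 0 < y 0} ∧
        Disjoint (tsupport g) (tsupport h) ∧ 0 < δ ∧
        ∀ᶠ k in atTop, δ ≤
          |latticeSchwinger r.ρ sch (fun s => s.F) k 3 (fun _ => r.curvature) ![f, g, h] -
            latticeSchwinger r.ρ sch (fun s => s.F) k 1 (fun _ => r.curvature) ![f] *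
              latticeSchwinger r.ρ sch (fun s => s.F) k 2 (fun _ => r.curvature) ![g, h] -
            latticeSchwinger r.ρ sch (fun s => s.F) k 1 (fun _ => r.curvature) ![g] *
              latticeSchwinger r.ρ sch (fun s => s.F) k 2 (fun _ => r.curvature) ![f, h] -
            latticeSchwinger r.ρ sch (fun s => s.F) k 1 (fun _ => r.curvature) ![h] *
              latticeSchwinger r.ρ sch (fun s => s.F) k 2 (fun _ => r.curvature) ![f, g] +
            2 * (latticeSchwinger r.ρ sch (fun s => s.F) k 1 (fun _ => r.curvature) ![f] *
              latticeSchwinger r.ρ sch (fun s => s.F) k 1 (fun _ => r.curvature) ![g] *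
              latticeSchwinger r.ρ sch (fun s => s.F) k 1 (fun _ => r.curvature) ![h])|) :
    ∃ (sch' : SpeciesScheme (YMSpecies G)) (S₁ : SchwingerFamily (EuclideanSpace ℝ (Fin 4))), sch'.HasWeakCouplingLimit ∧ OneFieldClauses r sch' S₁ := by
  -- bounded counterterms from the κ₃ floor (`stub_countertermBoundOfSkewFloor`)
  have hbm : ∃ Cm : ℝ, ∀ k, |sch.m r.curvature k| ≤ Cm := by
    obtain ⟨f, g, h, δ, -, -, -, -, hδ, hev⟩ := hNG
    exact stub_countertermBoundOfSkewFloor G r sch hUMB ⟨f, g, h, δ, hδ, hev⟩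
  -- compactness along a subsequence
  have hUFB : UniformFunctionalBoundPlanes r sch := stub_functionalBoundPlanes G r sch hpv hUMB
  obtain ⟨φ, hφ, T, hPL⟩ := stub_planeLimits G r sch hUFB
  have hβ0 : ∀ᶠ k in atTop, 0 ≤ sch.β k := hw.eventually_ge_atTop 0
  -- soft facts
  obtain ⟨hE0, hE3⟩ := planeSum_isNormalized_isSymmetric G r sch φ T hPL
  have hE0' := planeSum_hasLinearGrowth G r sch φ T hPL
  have htr := stub_translationPlanesMono G r sch φ hφ T hpv hpr hUFB hPL
  have hconv := convergence_subseq_of_planeLimits G r sch φ hφ T hPL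
  -- reflection facts
  have hRP : RPPos (planeSum T) := stub_rpPosOfPlaneLimits G r sch φ hφ T hβ0 hUFB hPL
  have hSP := stub_signedPermOfPlaneLimits G r sch φ hφ T hUFB hPL
  have hD : Decay (planeSum T) Δ := stub_decayOfRPSpectral G r sch φ hφ T Δ C hΔ hpv hpr hbm hUFB hPL hrp
  have hrefl : ReflHalf (planeSum T) Δ :=
    reflHalf_of_pieces (planeSum T) hΔ hE0 (fun n _ a F hF => htr n a F hF) hRP hSP hD
  -- `ConnCS` of the limit (landed `stub_gap`)
  have hN' : ∀ F : 𝓢((Fin 0 → EuclideanSpace ℝ (Fin 4)), ℂ), planeSum T 0 F = F default := fun F =>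
    (hE0 (fun _ => ()) F).trans (congrArg F (Subsingleton.elim _ _))
  have htrans' : ∀ (n : ℕ) (t : EuclideanSpace ℝ (Fin 4)) (F : 𝓢((Fin n → EuclideanSpace ℝ (Fin 4)), ℂ)), IsOffDiagonal F →
      planeSum T n (translateMulti t F) = planeSum T n F := fun n t F hF => htr n t F hF
  obtain ⟨hCS, -⟩ :=
    Summit.QuantumFields.YangMills.Cruxes.OSLegsFromFemtoAndGap.DlrCollarTransfer.stub_gap (planeSum T) hN' htrans' hRP
  -- the κ₃ floor along the subsequence, its continuum (time-separated) non-Gaussianity data, non-triviality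
  have hNG' : ∃ (f g h : 𝓢(EuclideanSpace ℝ (Fin 4), ℝ)) (δ : ℝ),
      tsupport f ⊆ {y : EuclideanSpace ℝ (Fin 4) | y 0 < 0} ∧ tsupport g ⊆ {y : EuclideanSpace ℝ (Fin 4) | 0 < y 0} ∧ tsupport h ⊆ {y : EuclideanSpace ℝ (Fin 4) | 0 < y 0} ∧
      Disjoint (tsupport g) (tsupport h) ∧ 0 < δ ∧
      ∀ᶠ k in atTop, δ ≤
        |latticeSchwinger r.ρ (subseq sch φ hφ) (fun s => s.F) k 3 (fun _ => r.curvature) ![f, g, h] -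
          latticeSchwinger r.ρ (subseq sch φ hφ) (fun s => s.F) k 1 (fun _ => r.curvature) ![f] *
            latticeSchwinger r.ρ (subseq sch φ hφ) (fun s => s.F) k 2 (fun _ => r.curvature) ![g, h] -
          latticeSchwinger r.ρ (subseq sch φ hφ) (fun s => s.F) k 1 (fun _ => r.curvature) ![g] *
            latticeSchwinger r.ρ (subseq sch φ hφ) (fun s => s.F) k 2 (fun _ => r.curvature) ![f, h] -
          latticeSchwinger r.ρ (subseq sch φ hφ) (fun s => s.F) k 1 (fun _ => r.curvature) ![h] *
            latticeSchwinger r.ρ (subseq sch φ hφ) (fun s => s.F) k 2 (fun _ => r.curvature) ![f, g] +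
          2 * (latticeSchwinger r.ρ (subseq sch φ hφ) (fun s => s.F) k 1 (fun _ => r.curvature) ![f] *
            latticeSchwinger r.ρ (subseq sch φ hφ) (fun s => s.F) k 1 (fun _ => r.curvature) ![g] *
            latticeSchwinger r.ρ (subseq sch φ hφ) (fun s => s.F) k 1 (fun _ => r.curvature) ![h])| := by
    obtain ⟨f, g, h, δ, hf, hg, hh, hgh, hδ, hev⟩ := hNG
    exact ⟨f, g, h, δ, hf, hg, hh, hgh, hδ, eventually_subseq hφ hev⟩
  have hsep := stub_skewSeparatedOfLatticeFloor G r (subseq sch φ hφ) (planeSum T) hconv hNG'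
  have hNT := stub_ntOfSkewSeparated (planeSum T) hCS hsep
  have hNGc : ∃ (f g h : 𝓢(EuclideanSpace ℝ (Fin 4), ℂ)) (Ffgh : 𝓢((Fin 3 → EuclideanSpace ℝ (Fin 4)), ℂ)) (Fgh Ffh Ffg : 𝓢((Fin 2 → EuclideanSpace ℝ (Fin 4)), ℂ))
      (Ff Fg Fh : 𝓢((Fin 1 → EuclideanSpace ℝ (Fin 4)), ℂ)),
      IsTensorOf Ffgh ![f, g, h] ∧ IsOffDiagonal Ffgh ∧ IsTensorOf Fgh ![g, h] ∧
      IsTensorOf Ffh ![f, h] ∧ IsTensorOf Ffg ![f, g] ∧ IsTensorOf Ff ![f] ∧ IsTensorOf Fg ![g] ∧ IsTensorOf Fh ![h] ∧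
      (planeSum T).toLabelled 3 (fun _ => ()) Ffgh -
          (planeSum T).toLabelled 1 (fun _ => ()) Ff * (planeSum T).toLabelled 2 (fun _ => ()) Fgh -
        (planeSum T).toLabelled 1 (fun _ => ()) Fg * (planeSum T).toLabelled 2 (fun _ => ()) Ffh -
        (planeSum T).toLabelled 1 (fun _ => ()) Fh * (planeSum T).toLabelled 2 (fun _ => ()) Ffg +
        2 * ((planeSum T).toLabelled 1 (fun _ => ()) Ff * (planeSum T).toLabelled 1 (fun _ => ()) Fg *
          (planeSum T).toLabelled 1 (fun _ => ()) Fh) ≠ 0 := by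
    obtain ⟨f, g, h, Ffgh, Fgh, Ffh, Ffg, Ff, Fg, Fh, -, -, -, -, h1, h2, h3, h4, h5, h6, h7, h8, h9⟩ := hsep
    exact ⟨f, g, h, Ffgh, Fgh, Ffh, Ffg, Ff, Fg, Fh, h1, h2, h3, h4, h5, h6, h7, h8, h9⟩
  -- assemble the soft half and conclude
  have hsoft : SoftHalf r (subseq sch φ hφ) (planeSum T) Δ :=
    ⟨hE0, hE0', hE3, fun n _ a F hF => htr n a F hF, hconv, hNT, hNGc, hasLatticeMassGap_subseq r sch φ hφ hgap⟩
  exact ⟨subseq sch φ hφ, planeSum T, hasWeakCouplingLimit_subseq sch φ hφ hw, oneFieldClauses_of_halves r _ _ hΔ hsoft hrefl⟩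


/-- **The twin crux `HypercubicLimit` (stmt-16154) from the skew core.** [folklore] -/
theorem hypercubicLimit_of_latticeSkewCore
    (hcore : ∀ (G : Type) [Group G] [TopologicalSpace G] [IsTopologicalGroup G] [CompactSpace G]
      [MeasurableSpace G] [BorelSpace G], IsCompactSimpleLieGroup G →
      ∃ (r : LatticeRep G) (sch : SpeciesScheme (YMSpecies G)),
        sch.HasWeakCouplingLimit ∧ PolyVolume sch ∧ PolyRenorm r sch ∧ UniformMomentBoundsPlanes r sch ∧
        (∃ Δ C : ℝ, 0 < Δ ∧ HasLatticeMassGap r sch Δ ∧ RPSpectral r sch Δ C) ∧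
        (∃ (f g h : 𝓢(EuclideanSpace ℝ (Fin 4), ℝ)) (δ : ℝ),
          tsupport f ⊆ {y : EuclideanSpace ℝ (Fin 4) | y 0 < 0} ∧ tsupport g ⊆ {y : EuclideanSpace ℝ (Fin 4) | 0 < y 0} ∧ tsupport h ⊆ {y : EuclideanSpace ℝ (Fin 4) | 0 < y 0} ∧
          Disjoint (tsupport g) (tsupport h) ∧ 0 < δ ∧
          ∀ᶠ k in atTop, δ ≤
            |latticeSchwinger r.ρ sch (fun s => s.F) k 3 (fun _ => r.curvature) ![f, g, h] -
              latticeSchwinger r.ρ sch (fun s => s.F) k 1 (fun _ => r.curvature) ![f] *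
                latticeSchwinger r.ρ sch (fun s => s.F) k 2 (fun _ => r.curvature) ![g, h] -
              latticeSchwinger r.ρ sch (fun s => s.F) k 1 (fun _ => r.curvature) ![g] *
                latticeSchwinger r.ρ sch (fun s => s.F) k 2 (fun _ => r.curvature) ![f, h] -
              latticeSchwinger r.ρ sch (fun s => s.F) k 1 (fun _ => r.curvature) ![h] *
                latticeSchwinger r.ρ sch (fun s => s.F) k 2 (fun _ => r.curvature) ![f, g] +
              2 * (latticeSchwinger r.ρ sch (fun s => s.F) k 1 (fun _ => r.curvature) ![f] *
                latticeSchwinger r.ρ sch (fun s => s.F) k 1 (fun _ => r.curvature) ![g] *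
                latticeSchwinger r.ρ sch (fun s => s.F) k 1 (fun _ => r.curvature) ![h])|)) :
    Summit.QuantumFields.YangMills.Theses.CoincidenceRotationBootstrap.HypercubicLimit := by
  refine Summit.QuantumFields.YangMills.Theorems.HypercubicLimit.OneFieldWeak.hypercubicLimit_iff_oneFieldWeak.mpr
    fun G _ _ _ _ hG => ?_
  letI : MeasurableSpace G := borel G
  haveI : BorelSpace G := ⟨rfl⟩
  obtain ⟨r, sch, hw, hpv, hpr, hUMB, ⟨Δ, C, hΔ, hgap, hrp⟩, hNG⟩ := hcore G hG
  obtain ⟨sch', S₁, hw', h₁⟩ := oneFieldClauses_of_latticeSkewCore r sch hw hpv hpr hUMB hΔ hgap hrp hNG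
  exact ⟨r, sch', S₁, hw', h₁⟩

/-- **The crux `WeakCouplingHypercubicLimit` (stmt-16120) BY NAME from the skew core** — registered sub-goal of line `Sketch`, r12:
weak coupling ∧ `PolyVolume` ∧ `PolyRenorm` ∧ `UniformMomentBoundsPlanes` ∧ (uniform lattice gap ∧ its RP-spectral form) ∧ ONE
time-separated `κ₃` floor ⇒ the existence-minus-rotations leg of `YangMills` in one-field gauge at weak coupling. [folklore] -/
theorem weakCouplingHypercubicLimit_of_latticeSkewCore :
    (∀ (G : Type) [Group G] [TopologicalSpace G] [IsTopologicalGroup G] [CompactSpace G]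
      [MeasurableSpace G] [BorelSpace G], IsCompactSimpleLieGroup G →
      ∃ (r : LatticeRep G) (sch : SpeciesScheme (YMSpecies G)),
        sch.HasWeakCouplingLimit ∧ PolyVolume sch ∧ PolyRenorm r sch ∧ UniformMomentBoundsPlanes r sch ∧
        (∃ Δ C : ℝ, 0 < Δ ∧ HasLatticeMassGap r sch Δ ∧ RPSpectral r sch Δ C) ∧
        (∃ (f g h : 𝓢(EuclideanSpace ℝ (Fin 4), ℝ)) (δ : ℝ),
          tsupport f ⊆ {y : EuclideanSpace ℝ (Fin 4) | y 0 < 0} ∧ tsupport g ⊆ {y : EuclideanSpace ℝ (Fin 4) | 0 < y 0} ∧ tsupport h ⊆ {y : EuclideanSpace ℝ (Fin 4) | 0 < y 0} ∧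
          Disjoint (tsupport g) (tsupport h) ∧ 0 < δ ∧
          ∀ᶠ k in atTop, δ ≤
            |latticeSchwinger r.ρ sch (fun s => s.F) k 3 (fun _ => r.curvature) ![f, g, h] -
              latticeSchwinger r.ρ sch (fun s => s.F) k 1 (fun _ => r.curvature) ![f] *
                latticeSchwinger r.ρ sch (fun s => s.F) k 2 (fun _ => r.curvature) ![g, h] -
              latticeSchwinger r.ρ sch (fun s => s.F) k 1 (fun _ => r.curvature) ![g] *
                latticeSchwinger r.ρ sch (fun s => s.F) k 2 (fun _ => r.curvature) ![f, h] -
              latticeSchwinger r.ρ sch (fun s => s.F) k 1 (fun _ => r.curvature) ![h] *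
                latticeSchwinger r.ρ sch (fun s => s.F) k 2 (fun _ => r.curvature) ![f, g] +
              2 * (latticeSchwinger r.ρ sch (fun s => s.F) k 1 (fun _ => r.curvature) ![f] *
                latticeSchwinger r.ρ sch (fun s => s.F) k 1 (fun _ => r.curvature) ![g] *
                latticeSchwinger r.ρ sch (fun s => s.F) k 1 (fun _ => r.curvature) ![h])|)) →
    Summit.QuantumFields.YangMills.Theses.PencilRigidity.WeakCouplingHypercubicLimit := fun hcore =>
  Summit.QuantumFields.YangMills.Theorems.WeakCouplingHypercubicLimit.SiblingTie.stub_siblingTie.mpr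
    (hypercubicLimit_of_latticeSkewCore hcore)

end Summit.QuantumFields.YangMills.Theorems.WeakCouplingHypercubicLimit.TraceNormColdPressure

end
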